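import Literature.Topology.FourManifolds.TrisectionsAmbientPresentation
import Literature.Topology.FourManifolds.TrisectionsSectorNormalForm
import Literature.Topology.FourManifolds.TrisectionsSectorRestructure
import HarnessLib

/-!
# A Gay–Kirby trisection in normal form: the three sectors presented by ambient data for one
# common normal frame

Topic `Literature/Topology/FourManifolds`; infrastructure for the fact seat
`provefact-Literature.Topology.FourManifolds.exists-14560f9fc8` (named fact (c′)
`Literature.Topology.FourManifolds.exists_stabilized_gkTrisection`, Gay–Kirby 2016, Def. 8 and
Lemma 10).  Everything in this file is **proved**; no definitions, no named facts.

**Theorem (`IsGKTrisection.exists_triNormalForm`).**  *Let `S` be a trisection with corners of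
a closed smooth `4`-manifold `X` (`IsGKTrisection X g k S`) and `i, j, l` the three indices.
There are global normal coordinates `u, v`, opens `U ⊇ O ⊇ F = ⋂ S m` and a smooth retraction
`ρ` of `O` onto `F` such that `(S, i, j, l, u, v, ρ, U, O)` is a `TriNormalForm` with counts
`handleCount 1 (k m)`: the three sectors are the three wedges of the `(u, v)`-plane near `F`,
each carries corner-slice charts for the* same *retraction `ρ` (those of `S j`, `S l` are the
relabelled charts of `S i`, `CornerSliceChart.relabelTriRot(₂)`), half-slice charts off `F`, and
an ambient Morse presentation (`exists_ambientPresentation_of_normalForm` fed with the sector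
manifold of clause (ii)), and no sector meets the interior of another.*

This is the input of the stabilisation surgery, which is performed on such normal forms and
returns normal forms; the clauses of `IsGKTrisection` are recovered at the end
(`TriNormalForm.sectorClause`).

## References

* D. Gay, R. Kirby, *Trisecting 4-manifolds*, Geom. Topol. 20 (2016) 3097–3132, Def. 1 and
  Def. 8. [GayKirby2016]
* J. Milnor, *Morse theory*, Ann. of Math. Studies 51 (1963), §§2–3. [Milnor1963]
-/

open scoped Manifold ContDiff Topology
open Set Function Filter

noncomputable section

namespace Literature.Topology.FourManifolds

universe u

variable {X : Type u} [TopologicalSpace X] [T2Space X] [CompactSpace X]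
  [ChartedSpace (EuclideanSpace ℝ (Fin 4)) X] [IsManifold (𝓡 4) ∞ X]
  {g : ℕ} {k : Fin 3 → ℕ} {S : Fin 3 → Set X}

omit [CompactSpace X] in
/-- **No sector of a Gay–Kirby trisection meets the interior of another.**  A common point
`y ∈ S m ∩ S m'` is the image of a boundary point of the sector manifold of `S m` (clause (ii)),
while interior points of `S m` off `F` are images of interior points
(`apply_lt_one_of_mem_interior_range`) and points of `F` are not interior (given a corner-slice
chart there). [cite: GayKirby2016, Def. 1] -/
theorem IsGKTrisection.disjoint_interior_of_corner (h : IsGKTrisection X g k S) {m m' : Fin 3}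
    (hmm' : m ≠ m') (hF : ∀ x ∈ ⋂ n, S n, x ∉ interior (S m)) :
    Disjoint (interior (S m)) (S m') := by
  rw [Set.disjoint_left]
  intro y hint hy'
  obtain ⟨W, _, _, e, hM, hWc, -, ⟨f, hf, -⟩, he, hrange, himm, -, hbd⟩ := h.2.1 m
  haveI := hM
  have hyS : y ∈ S m := interior_subset hint
  have hyF : y ∉ ⋂ n, S n := fun hyF => hF y hyF hint
  obtain ⟨w, hwb, hwe⟩ := hbd m' (Ne.symm hmm') ⟨hyS, hy'⟩
  have hint' : e w ∈ interior (range e) := by rw [hrange, hwe]; exact hint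
  have hwint := (apply_lt_one_of_mem_interior_range he hf (himm w (by rw [hwe]; exact hyF)) hint').2
  exact (ModelWithCorners.isInteriorPoint_iff_not_isBoundaryPoint _ |>.1 hwint) hwb

omit [TopologicalSpace X] [T2Space X] [CompactSpace X] [ChartedSpace (EuclideanSpace ℝ (Fin 4)) X]
  [IsManifold (𝓡 4) ∞ X] in
/-- The face hypothesis of `exists_ambientPresentation_of_normalForm` for the first wedge.
[folklore] -/
theorem face_of_wedges {i j l : Fin 3} (hji : j ≠ i) (hli : l ≠ i) {u v : X → ℝ} {U : Set X}
    (hSi : ∀ y ∈ U, y ∈ S i ↔ 0 ≤ u y ∧ 0 ≤ v y)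
    (hSj : ∀ y ∈ U, y ∈ S j ↔ u y ≤ 0 ∧ u y ≤ v y)
    (hSl : ∀ y ∈ U, y ∈ S l ↔ v y ≤ 0 ∧ v y ≤ u y) :
    ∀ y ∈ U, y ∈ S i → (u y = 0 ∨ v y = 0) → ∃ j', j' ≠ i ∧ y ∈ S j' := by
  intro y hy hyS huv
  obtain ⟨hu0, hv0⟩ := (hSi y hy).1 hyS
  rcases huv with h0 | h0
  · exact ⟨j, hji, (hSj y hy).2 ⟨le_of_eq h0, by rw [h0]; exact hv0⟩⟩
  · exact ⟨l, hli, (hSl y hy).2 ⟨le_of_eq h0, by rw [h0]; exact hu0⟩⟩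

omit [TopologicalSpace X] [T2Space X] [CompactSpace X] [ChartedSpace (EuclideanSpace ℝ (Fin 4)) X]
  [IsManifold (𝓡 4) ∞ X] in
/-- The three wedges in the relabelled normal coordinates `(v - u, -u)`: `S j` becomes the
quadrant, `S l` the second wedge, `S i` the third. [folklore] -/
theorem wedges_triRot {i j l : Fin 3} {u v : X → ℝ} {U : Set X}
    (hSi : ∀ y ∈ U, y ∈ S i ↔ 0 ≤ u y ∧ 0 ≤ v y)
    (hSj : ∀ y ∈ U, y ∈ S j ↔ u y ≤ 0 ∧ u y ≤ v y)
    (hSl : ∀ y ∈ U, y ∈ S l ↔ v y ≤ 0 ∧ v y ≤ u y) :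
    (∀ y ∈ U, y ∈ S j ↔ 0 ≤ v y - u y ∧ 0 ≤ -u y) ∧
    (∀ y ∈ U, y ∈ S l ↔ v y - u y ≤ 0 ∧ v y - u y ≤ -u y) ∧
    (∀ y ∈ U, y ∈ S i ↔ -u y ≤ 0 ∧ -u y ≤ v y - u y) := by
  refine ⟨fun y hy => ?_, fun y hy => ?_, fun y hy => ?_⟩
  · rw [hSj y hy]; constructor <;> intro h <;> constructor <;> linarith [h.1, h.2]
  · rw [hSl y hy]; constructor <;> intro h <;> constructor <;> linarith [h.1, h.2]
  · rw [hSi y hy]; constructor <;> intro h <;> constructor <;> linarith [h.1, h.2]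

/-- **A sector in normal form from clause (ii) and corner-slice charts** (one wedge).  Given the
wedge descriptions of the three sectors in `U` for normal coordinates `(u, v)` adapted to
`S i`, the frame data, corner-slice charts of `S i` along `F` with sources in `O` and
half-slice charts of `S i` off `F`, the sector `S i` is in normal form with counts
`handleCount 1 (k i)` (`exists_ambientPresentation_of_normalForm`). [cite: GayKirby2016, Def. 1] -/
theorem IsGKTrisection.sectorNormalForm_of_charts (h : IsGKTrisection X g k S) {i j l : Fin 3}
    (hji : j ≠ i) (hli : l ≠ i) {u v : X → ℝ} {U O : Set X} {ρ : X → X}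
    (hfr : NormalFrame (⋂ m, S m) u v ρ U O)
    (hSi : ∀ y ∈ U, y ∈ S i ↔ 0 ≤ u y ∧ 0 ≤ v y)
    (hSj : ∀ y ∈ U, y ∈ S j ↔ u y ≤ 0 ∧ u y ≤ v y)
    (hSl : ∀ y ∈ U, y ∈ S l ↔ v y ≤ 0 ∧ v y ≤ u y)
    (hcorner : ∀ x ∈ ⋂ m, S m, ∃ C : CornerSliceChart (S i) (⋂ m, S m) u v ρ,
      x ∈ C.Θ.source ∧ C.Θ.source ⊆ O)
    (hhalf : ∀ p ∈ S i, p ∉ (⋂ m, S m) → ∃ D : HalfSliceChart (𝓡 4) (S i), p ∈ D.Θ.source ∧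
      ∀ q ∈ D.Θ.source, q ∉ ⋂ m, S m) :
    SectorNormalForm (S i) (⋂ m, S m) u v ρ U O (handleCount 1 (k i)) := by
  obtain ⟨W, _, _, e, hM, hWc, -, ⟨f, hf, hcount⟩, he, hrange, himm, hcor, hbd⟩ := h.2.1 i
  haveI := hM
  haveI := hWc
  have hface := face_of_wedges hji hli hSi hSj hSl
  obtain ⟨G, κ, Oκ, hGs, hκs, hOκo, hFOκ, hOκO, hκpos, hκρ, hGform, hint_iff, hb1, hi1, hb2, hi2,
    hnocrit, hc⟩ :=
    exists_ambientPresentation_of_normalForm he hrange himm hcor hbd hf hcount hfr.contMDiff_u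
      hfr.contMDiff_v hfr.isOpen_U hSi hfr.memF_iff hface hfr.isCompact_F hfr.isOpen_O
      hfr.F_subset_O hfr.O_subset_U hfr.contMDiff_ρ hfr.ρ_mem hfr.ρ_eq_self
      (fun x hx => by obtain ⟨C, hxC, -⟩ := hcorner x hx; exact ⟨C, hxC⟩)
  exact
    { isCompact := h.isCompact i
      mem_iff := hSi
      interior_iff := hint_iff
      corner := hcorner
      half := hhalf
      morse := ⟨G, κ, Oκ, hGs, hκs, hOκo, hFOκ, hOκO, hκpos, hκρ, hGform, hb1, hi1, hb2, hi2,
        hnocrit, hc⟩ }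

/-- **A Gay–Kirby trisection in normal form.**  For a trisection with corners `S` of a closed
smooth `4`-manifold and the three indices `i, j, l`, there is a common normal frame
`(u, v, ρ, U, O)` along `F = ⋂ S m` for which `S` is a `TriNormalForm` with counts
`handleCount 1 (k m)`. [cite: GayKirby2016, Def. 1 and Def. 8] -/
theorem IsGKTrisection.exists_triNormalForm (h : IsGKTrisection X g k S) {i j l : Fin 3}
    (hij : i ≠ j) (hjl : j ≠ l) (hil : i ≠ l) :
    ∃ (u v : X → ℝ) (U O : Set X) (ρ : X → X),
      TriNormalForm S i j l u v ρ U O (fun m => handleCount 1 (k m)) := by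
  obtain ⟨u, v, U, O, ρ, l', hl'i, hl'j, hUo, hOo, hFO, hOU, hu, hv, hρs, hSi, hSj, hSl, hF, hρF,
    hρfix, hρO, Φ, hΦO⟩ := h.exists_cornerSliceAtlas hij.symm
  -- the third index is `l`
  have hl'l : l' = l := by
    rcases Fin.eq_or_eq_or_eq_of_ne hij hjl hil l' with h' | h' | h'
    · exact absurd h' hl'i
    · exact absurd h' hl'j
    · exact h'
  rw [hl'l] at hSl
  have hfr : NormalFrame (⋂ m, S m) u v ρ U O :=
    { isOpen_U := hUo
      isOpen_O := hOo
      isCompact_F := h.isCompact_iInter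
      F_subset_O := hFO
      O_subset_U := hOU
      contMDiff_u := hu
      contMDiff_v := hv
      contMDiff_ρ := hρs
      memF_iff := hF
      ρ_mem := hρF
      ρ_eq_self := hρfix
      mapsTo_ρ := hρO }
  -- ### half-slice charts of the three sectors off `F` (from their own corner-slice atlases)
  have hhalf : ∀ m : Fin 3, ∀ p ∈ S m, p ∉ (⋂ n, S n) →
      ∃ D : HalfSliceChart (𝓡 4) (S m), p ∈ D.Θ.source ∧ ∀ q ∈ D.Θ.source, q ∉ ⋂ n, S n := by
    intro m p hpS hpF
    -- any other index
    obtain ⟨m', hm'⟩ : ∃ m', m' ≠ m := ⟨m + 1, by fin_cases m <;> decide⟩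
    obtain ⟨_, _, _, _, _, _, -, -, -, -, -, -, -, -, -, -, -, -, -, -, -, -, Φm, -⟩ :=
      h.exists_cornerSliceAtlas hm'
    exact ⟨Φm.halfDatum ⟨p, hpS⟩ hpF, Φm.half_mem_source ⟨p, hpS⟩ hpF, Φm.half_not_mem ⟨p, hpS⟩ hpF⟩
  -- ### corner-slice charts of `S i`, and the relabelled ones of `S j`, `S l`
  have hci : ∀ x ∈ ⋂ m, S m, ∃ C : CornerSliceChart (S i) (⋂ m, S m) u v ρ,
      x ∈ C.Θ.source ∧ C.Θ.source ⊆ O := fun x hx =>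
    ⟨Φ.cornerDatum ⟨x, mem_iInter.1 hx i⟩ hx, Φ.corner_mem_source _ hx, hΦO _ hx⟩
  have hcj : ∀ x ∈ ⋂ m, S m, ∃ C : CornerSliceChart (S j) (⋂ m, S m) (fun y => v y - u y)
      (fun y => -u y) ρ, x ∈ C.Θ.source ∧ C.Θ.source ⊆ O := by
    intro x hx
    obtain ⟨C, hxC, hCO⟩ := hci x hx
    refine ⟨C.relabelTriRot (fun q hq => hSj q (hOU (hCO hq))), ?_, ?_⟩
    · rw [C.relabelTriRot_source]; exact hxC
    · rw [C.relabelTriRot_source]; exact hCO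
  have hcl : ∀ x ∈ ⋂ m, S m, ∃ C : CornerSliceChart (S l) (⋂ m, S m) (fun y => -v y)
      (fun y => u y - v y) ρ, x ∈ C.Θ.source ∧ C.Θ.source ⊆ O := by
    intro x hx
    obtain ⟨C, hxC, hCO⟩ := hci x hx
    refine ⟨C.relabelTriRot₂ (fun q hq => hSl q (hOU (hCO hq))), ?_, ?_⟩
    · rw [C.relabelTriRot₂_source]; exact hxC
    · rw [C.relabelTriRot₂_source]; exact hCO
  -- ### the three sector normal forms
  have hSi' := h.sectorNormalForm_of_charts hij.symm (Ne.symm hil) hfr hSi hSj hSl hci (hhalf i)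
  obtain ⟨hSj₁, hSl₁, hSi₁⟩ := wedges_triRot hSi hSj hSl
  have hSj' := h.sectorNormalForm_of_charts hjl.symm hij hfr.relabelTriRot hSj₁ hSl₁ hSi₁ hcj (hhalf j)
  obtain ⟨hSl₂, hSi₂, hSj₂⟩ := wedges_triRot hSj₁ hSl₁ hSi₁
  have hSl₂' : ∀ y ∈ U, y ∈ S l ↔ 0 ≤ -v y ∧ 0 ≤ u y - v y := by
    intro y hy; rw [hSl₂ y hy]; constructor <;> intro h <;> constructor <;> linarith [h.1, h.2]
  have hSi₂' : ∀ y ∈ U, y ∈ S i ↔ -v y ≤ 0 ∧ -v y ≤ u y - v y := by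
    intro y hy; rw [hSi₂ y hy]; constructor <;> intro h <;> constructor <;> linarith [h.1, h.2]
  have hSj₂' : ∀ y ∈ U, y ∈ S j ↔ u y - v y ≤ 0 ∧ u y - v y ≤ -v y := by
    intro y hy; rw [hSj₂ y hy]; constructor <;> intro h <;> constructor <;> linarith [h.1, h.2]
  have hSl' := h.sectorNormalForm_of_charts hil hjl hfr.relabelTriRot₂ hSl₂' hSi₂' hSj₂' hcl (hhalf l)
  -- ### disjointness of interiors
  have hFnot : ∀ m, ∀ x ∈ ⋂ n, S n, x ∉ interior (S m) := by
    intro m x hx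
    rcases Fin.eq_or_eq_or_eq_of_ne hij hjl hil m with rfl | rfl | rfl
    · exact hSi'.not_mem_interior_of_mem_F hx
    · exact hSj'.not_mem_interior_of_mem_F hx
    · exact hSl'.not_mem_interior_of_mem_F hx
  refine ⟨u, v, U, O, ρ,
    { ne_ij := hij
      ne_jl := hjl
      ne_il := hil
      cover := h.1
      frame := hfr
      mem_j := hSj
      mem_l := hSl
      sector_i := hSi'
      sector_j := hSj'
      sector_l := hSl'
      disjoint := fun m m' hmm' => h.disjoint_interior_of_corner hmm' (hFnot m) }⟩

end Literature.Topology.FourManifolds
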